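import Literature.Analysis.FluidPDE.PlanarStreamGluing
import HarnessLib

/-!
# General linear frames: conjugating explicit planar moves by an invertible linear map

Topic `Literature/Analysis/FluidPDE`. Ninth file of the explicit pullback calculus for the planar
transport equation. `PlanarDiagonalFrame.lean` conjugates explicit moves by the one frame
`(u, v) = (x - y, x + y)`; the rectilinear designs need a handful more (the swap `(y, x)` for
vertical runs, the flip `(x, -y)` and the anti-diagonal for corners turning the other way). This
file does the conjugation once for an ARBITRARY invertible linear frame
`A z = (a z₀ + b z₁, c z₀ + d z₁)`, `ad - bc ≠ 0` (`LinFrame`), with inverse `A⁻¹` by Cramer: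

* `A`, `A⁻¹` and their continuous-linear versions, inverse identities, derivatives;
* the chain rule `D(Θ ∘ A)(z)[v] = DΘ(Az)[Av]` and **frame invariance of the transport
  expression**: `Θ(t, A·)`, `A⁻¹ V(t, A·)` have at `(t,z)` the transport expression of `(Θ, V)` at
  `(t, Az)` (`transport_conj`);
* **frame invariance of the divergence**, `div(A⁻¹ V ∘ A)(z) = (div V)(Az)` (the trace of
  `A⁻¹ (DV) A`; `divergence_conj`);
* **perpendicular gradients**: `A⁻¹ (∂₁H, -∂₀H)(Az) = det(A)⁻¹ ∇⊥(H ∘ A)(z)` (`inv_perp_fderiv`,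
  `conj_perpGrad`): the conjugate of `∇⊥H` is `∇⊥` of the stream function `det(A)⁻¹ · H ∘ A`;
* joint smoothness of conjugated fields; the instances `swap`, `flipY`, `antiDiag`.

Folklore; no named facts. Infrastructure towards a discharge of `acm_compatible_blocks`
(`QuasiSelfSimilarCompatibleBlocks.lean`).

## References

* G. Alberti, G. Crippa, A. L. Mazzucato, *Exponential self-similar mixing by incompressible
  flows*, J. Amer. Math. Soc. 32 (2019), 445–490, §7 (arXiv:1605.02090).
-/

noncomputable section

open Function Set Filter
open scoped Topology ContDiff

namespace Literature.Analysis.FluidPDE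

namespace PlanarKinematics

/-- The plane `ℝ²` as a Euclidean space. [folklore] -/
local notation "E²" => EuclideanSpace ℝ (Fin 2)

variable {G : Type*} [NormedAddCommGroup G] [NormedSpace ℝ G]

/-- **An invertible linear frame of the plane**: the matrix `(a b; c d)` with `ad - bc ≠ 0`.
[folklore] -/
structure LinFrame where
  /-- entry `(0,0)` -/
  a : ℝ
  /-- entry `(0,1)` -/
  b : ℝ
  /-- entry `(1,0)` -/
  c : ℝ
  /-- entry `(1,1)` -/
  d : ℝ
  /-- invertibility -/
  det_ne : a * d - b * c ≠ 0

namespace LinFrame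

variable (A : LinFrame)

/-- The determinant `ad - bc`. [folklore] -/
def det : ℝ := A.a * A.d - A.b * A.c

/-- The determinant is nonzero. [folklore] -/
theorem det_ne_zero : A.det ≠ 0 := A.det_ne

/-- **The frame map** `A z = (a z₀ + b z₁, c z₀ + d z₁)`. [folklore] -/
def app (z : E²) : E² := vec2 (A.a * z 0 + A.b * z 1) (A.c * z 0 + A.d * z 1)

/-- **The inverse frame map** (Cramer) `A⁻¹ w = ((d w₀ - b w₁)/det, (-c w₀ + a w₁)/det)`. [folklore] -/
def inv (w : E²) : E² := vec2 ((A.d * w 0 - A.b * w 1) / A.det) ((-A.c * w 0 + A.a * w 1) / A.det)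

/-- Unfolding `A`. [folklore] -/
theorem app_apply (z : E²) : A.app z = vec2 (A.a * z 0 + A.b * z 1) (A.c * z 0 + A.d * z 1) := rfl

/-- Unfolding `A⁻¹`. [folklore] -/
theorem inv_apply (w : E²) :
    A.inv w = vec2 ((A.d * w 0 - A.b * w 1) / A.det) ((-A.c * w 0 + A.a * w 1) / A.det) := rfl

/-- `A⁻¹ ∘ A = id`. [folklore] -/
@[simp]
theorem inv_app (z : E²) : A.inv (A.app z) = z := by
  have hD := A.det_ne_zero
  rw [inv_apply, app_apply, vec2_apply_zero, vec2_apply_one]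
  refine (vec2_eq_vec2_iff.2 ⟨?_, ?_⟩).trans (vec2_apply_eq z)
  · field_simp; unfold det; ring
  · field_simp; unfold det; ring

/-- `A ∘ A⁻¹ = id`. [folklore] -/
@[simp]
theorem app_inv (w : E²) : A.app (A.inv w) = w := by
  have hD := A.det_ne_zero
  rw [app_apply, inv_apply, vec2_apply_zero, vec2_apply_one]
  refine (vec2_eq_vec2_iff.2 ⟨?_, ?_⟩).trans (vec2_apply_eq w)
  · rw [mul_div_assoc', mul_div_assoc', ← add_div, div_eq_iff hD]; unfold det; ring
  · rw [mul_div_assoc', mul_div_assoc', ← add_div, div_eq_iff hD]; unfold det; ring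

/-- `A` on the first basis vector. [folklore] -/
theorem app_single_zero : A.app (EuclideanSpace.single 0 1) = vec2 A.a A.c := by
  rw [app_apply]; simp

/-- `A` on the second basis vector. [folklore] -/
theorem app_single_one : A.app (EuclideanSpace.single 1 1) = vec2 A.b A.d := by
  rw [app_apply]; simp

/-- A `vec2` in the standard basis. [folklore] -/
theorem vec2_eq_single_add (p q : ℝ) :
    (vec2 p q : E²) = p • EuclideanSpace.single 0 1 + q • EuclideanSpace.single 1 1 := by
  ext i; fin_cases i <;> simp [vec2]

/-! ## Derivatives of the frame maps -/

/-- **`A` as a continuous linear map** (its own derivative). [folklore] -/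
def appL : E² →L[ℝ] E² :=
  (A.a • (EuclideanSpace.proj (0 : Fin 2) : E² →L[ℝ] ℝ) + A.b • (EuclideanSpace.proj (1 : Fin 2) : E² →L[ℝ] ℝ)).smulRight
      (EuclideanSpace.single 0 1) +
    (A.c • (EuclideanSpace.proj (0 : Fin 2) : E² →L[ℝ] ℝ) + A.d • (EuclideanSpace.proj (1 : Fin 2) : E² →L[ℝ] ℝ)).smulRight
      (EuclideanSpace.single 1 1)

/-- The continuous linear map `appL` is `A`. [folklore] -/
@[simp]
theorem appL_apply (v : E²) : A.appL v = A.app v := by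
  simp only [appL, _root_.add_apply, ContinuousLinearMap.smulRight_apply, _root_.smul_apply,
    PiLp.proj_apply, app_apply, vec2, smul_eq_mul]

/-- **`A⁻¹` as a continuous linear map.** [folklore] -/
def invL : E² →L[ℝ] E² :=
  ((A.d / A.det) • (EuclideanSpace.proj (0 : Fin 2) : E² →L[ℝ] ℝ) +
      (-A.b / A.det) • (EuclideanSpace.proj (1 : Fin 2) : E² →L[ℝ] ℝ)).smulRight (EuclideanSpace.single 0 1) +
    ((-A.c / A.det) • (EuclideanSpace.proj (0 : Fin 2) : E² →L[ℝ] ℝ) +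
      (A.a / A.det) • (EuclideanSpace.proj (1 : Fin 2) : E² →L[ℝ] ℝ)).smulRight (EuclideanSpace.single 1 1)

/-- The continuous linear map `invL` is `A⁻¹`. [folklore] -/
@[simp]
theorem invL_apply (v : E²) : A.invL v = A.inv v := by
  simp only [invL, _root_.add_apply, ContinuousLinearMap.smulRight_apply, _root_.smul_apply,
    PiLp.proj_apply, inv_apply, vec2, smul_eq_mul]
  congr 1 <;> ring

/-- **`DA = A`** at every point. [folklore] -/
theorem hasFDerivAt_app (z : E²) : HasFDerivAt A.app A.appL z := by
  have h := A.appL.hasFDerivAt (x := z)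
  have e : (A.appL : E² → E²) = A.app := funext A.appL_apply
  rwa [e] at h

/-- **`DA⁻¹ = A⁻¹`** at every point. [folklore] -/
theorem hasFDerivAt_inv (w : E²) : HasFDerivAt A.inv A.invL w := by
  have h := A.invL.hasFDerivAt (x := w)
  have e : (A.invL : E² → E²) = A.inv := funext A.invL_apply
  rwa [e] at h

/-- `A` is differentiable. [folklore] -/
theorem differentiableAt_app (z : E²) : DifferentiableAt ℝ A.app z := (A.hasFDerivAt_app z).differentiableAt

/-- `A` is smooth. [folklore] -/
theorem contDiff_app {n : WithTop ℕ∞} : ContDiff ℝ n A.app := by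
  have e : (A.appL : E² → E²) = A.app := funext A.appL_apply
  rw [← e]; exact A.appL.contDiff

/-- `A⁻¹` is smooth. [folklore] -/
theorem contDiff_inv {n : WithTop ℕ∞} : ContDiff ℝ n A.inv := by
  have e : (A.invL : E² → E²) = A.inv := funext A.invL_apply
  rw [← e]; exact A.invL.contDiff

/-- **Chain rule through the frame**: `D(Θ ∘ A)(z)[v] = DΘ(A z)[A v]`. [folklore] -/
theorem fderiv_comp_apply {Θ : E² → G} {z : E²} (hΘ : DifferentiableAt ℝ Θ (A.app z)) (v : E²) :
    fderiv ℝ (fun w => Θ (A.app w)) z v = fderiv ℝ Θ (A.app z) (A.app v) := by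
  have h : HasFDerivAt (fun w => Θ (A.app w)) ((fderiv ℝ Θ (A.app z)).comp A.appL) z :=
    hΘ.hasFDerivAt.comp z (A.hasFDerivAt_app z)
  rw [h.fderiv, ContinuousLinearMap.comp_apply, appL_apply]

/-- Slices of a conjugated scalar are differentiable where the frame scalar is. [folklore] -/
theorem differentiableAt_comp {Θ : E² → G} {z : E²} (hΘ : DifferentiableAt ℝ Θ (A.app z)) :
    DifferentiableAt ℝ (fun w => Θ (A.app w)) z :=
  hΘ.comp z (A.differentiableAt_app z)

/-! ## Conjugated moves: transport and divergence -/

/-- **The transport expression is frame invariant.** [folklore] -/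
theorem transportExpr_conj {Θ : ℝ → E² → G} (V : ℝ → E² → E²) {t : ℝ} {z : E²}
    (hΘ : DifferentiableAt ℝ (Θ t) (A.app z)) :
    deriv (fun s => Θ s (A.app z)) t + fderiv ℝ (fun w => Θ t (A.app w)) z (A.inv (V t (A.app z))) =
      deriv (fun s => Θ s (A.app z)) t + fderiv ℝ (Θ t) (A.app z) (V t (A.app z)) := by
  rw [A.fderiv_comp_apply hΘ, app_inv]

/-- **Transported frame fields give transported physical fields.** [folklore] -/
theorem transport_conj {Θ : ℝ → E² → G} {V : ℝ → E² → E²} {t : ℝ} {z : E²}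
    (hΘ : DifferentiableAt ℝ (Θ t) (A.app z))
    (h : deriv (fun s => Θ s (A.app z)) t + fderiv ℝ (Θ t) (A.app z) (V t (A.app z)) = 0) :
    deriv (fun s => Θ s (A.app z)) t + fderiv ℝ (fun w => Θ t (A.app w)) z (A.inv (V t (A.app z))) = 0 := by
  rw [A.transportExpr_conj V hΘ, h]

/-- **Derivative of a conjugated velocity**: `D(A⁻¹ V ∘ A)(z) = A⁻¹ ∘ DV(A z) ∘ A`. [folklore] -/
theorem hasFDerivAt_conj {V : E² → E²} {z : E²} (hV : DifferentiableAt ℝ V (A.app z)) :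
    HasFDerivAt (fun w => A.inv (V (A.app w))) (A.invL.comp ((fderiv ℝ V (A.app z)).comp A.appL)) z :=
  (A.hasFDerivAt_inv _).comp z (hV.hasFDerivAt.comp z (A.hasFDerivAt_app z))

/-- **The divergence is frame invariant**: `div (A⁻¹ V ∘ A)(z) = div V (A z)` (the trace of
`A⁻¹ (DV) A` equals the trace of `DV`, by `A A⁻¹ = I` entrywise). [folklore] -/
theorem divergence_conj {V : E² → E²} {z : E²} (hV : DifferentiableAt ℝ V (A.app z)) :
    ∑ j, fderiv ℝ (fun w => A.inv (V (A.app w))) z (EuclideanSpace.single j 1) j =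
      ∑ j, fderiv ℝ V (A.app z) (EuclideanSpace.single j 1) j := by
  have hD := A.det_ne_zero
  set M := fderiv ℝ V (A.app z) with hM
  rw [(A.hasFDerivAt_conj hV).fderiv, Fin.sum_univ_two, Fin.sum_univ_two]
  simp only [ContinuousLinearMap.comp_apply, appL_apply, invL_apply, app_single_zero, app_single_one]
  rw [vec2_eq_single_add A.a A.c, vec2_eq_single_add A.b A.d, map_add, map_add, map_smul, map_smul,
    map_smul, map_smul]
  simp only [inv_apply, vec2_apply_zero, vec2_apply_one, PiLp.add_apply, PiLp.smul_apply, smul_eq_mul]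
  field_simp
  unfold det
  ring

/-- **Divergence-free frame fields give divergence-free physical fields.** [folklore] -/
theorem divergence_conj_eq_zero {V : E² → E²} {z : E²} (hV : DifferentiableAt ℝ V (A.app z))
    (h : ∑ j, fderiv ℝ V (A.app z) (EuclideanSpace.single j 1) j = 0) :
    ∑ j, fderiv ℝ (fun w => A.inv (V (A.app w))) z (EuclideanSpace.single j 1) j = 0 := by
  rw [A.divergence_conj hV, h]

/-! ## Stream functions through the frame -/

/-- **Perpendicular gradients are mapped to perpendicular gradients**:
`A⁻¹ (∂₁H, -∂₀H)(A z) = det(A)⁻¹ (∂₁(H∘A), -∂₀(H∘A))(z)`. [folklore] -/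
theorem inv_perp_fderiv {H : E² → ℝ} {z : E²} (hH : DifferentiableAt ℝ H (A.app z)) :
    A.inv (vec2 (fderiv ℝ H (A.app z) (EuclideanSpace.single 1 1)) (-fderiv ℝ H (A.app z) (EuclideanSpace.single 0 1))) =
      vec2 (A.det⁻¹ * fderiv ℝ (fun w => H (A.app w)) z (EuclideanSpace.single 1 1))
        (-(A.det⁻¹ * fderiv ℝ (fun w => H (A.app w)) z (EuclideanSpace.single 0 1))) := by
  have hD := A.det_ne_zero
  rw [A.fderiv_comp_apply hH, A.fderiv_comp_apply hH, app_single_zero, app_single_one,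
    vec2_eq_single_add A.a A.c, vec2_eq_single_add A.b A.d, map_add, map_add, map_smul, map_smul, map_smul,
    map_smul, inv_apply, vec2_apply_zero, vec2_apply_one, vec2_eq_vec2_iff, smul_eq_mul, smul_eq_mul, smul_eq_mul,
    smul_eq_mul]
  constructor
  · field_simp; ring
  · field_simp; ring

/-- **The conjugate of a perpendicular gradient is the perpendicular gradient of the scaled
conjugate stream function**: `A⁻¹ ∇⊥H (A z) = ∇⊥(det(A)⁻¹ · H ∘ A)(z)`. [folklore] -/
theorem conj_perpGrad {H : E² → ℝ} {z : E²} (hH : DifferentiableAt ℝ H (A.app z)) :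
    A.inv (perpGrad H (A.app z)) = perpGrad (fun w => A.det⁻¹ * H (A.app w)) z := by
  rw [perpGrad_apply, A.inv_perp_fderiv hH]
  have hd : DifferentiableAt ℝ (fun w => H (A.app w)) z := A.differentiableAt_comp hH
  refine vec2_eq_perpGrad ?_ ?_
  · rw [fderiv_const_mul hd]; rfl
  · rw [fderiv_const_mul hd]; rfl

/-! ## Smoothness of conjugated fields -/

/-- **A scalar read through the frame is as smooth** (jointly in `(t, z)`). [folklore] -/
theorem contDiff_uncurry_comp {Θ : ℝ → E² → G} {n : WithTop ℕ∞} (hΘ : ContDiff ℝ n (uncurry Θ)) :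
    ContDiff ℝ n (uncurry fun t z => Θ t (A.app z)) :=
  hΘ.comp (contDiff_fst.prodMk (A.contDiff_app.comp contDiff_snd))

/-- **A conjugated velocity is as smooth** (jointly in `(t, z)`). [folklore] -/
theorem contDiff_uncurry_conj {V : ℝ → E² → E²} {n : WithTop ℕ∞} (hV : ContDiff ℝ n (uncurry V)) :
    ContDiff ℝ n (uncurry fun t z => A.inv (V t (A.app z))) :=
  A.contDiff_inv.comp (hV.comp (contDiff_fst.prodMk (A.contDiff_app.comp contDiff_snd)))

/-! ## Instances -/

/-- **The swap frame** `(z₁, z₀)` (vertical runs as graphs; `det = -1`). [folklore] -/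
def swap : LinFrame := ⟨0, 1, 1, 0, by norm_num⟩

/-- **The flip frame** `(z₀, -z₁)` (corners turning north as corners turning south; `det = -1`).
[folklore] -/
def flipY : LinFrame := ⟨1, 0, 0, -1, by norm_num⟩

/-- **The diagonal frame** `(z₀ - z₁, z₀ + z₁)` of `PlanarDiagonalFrame.lean` (`det = 2`). [folklore] -/
def diag : LinFrame := ⟨1, -1, 1, 1, by norm_num⟩

/-- **The anti-diagonal frame** `(z₀ + z₁, z₁ - z₀)` (`det = 2`). [folklore] -/
def antiDiag : LinFrame := ⟨1, 1, -1, 1, by norm_num⟩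

/-- The swap frame map. [folklore] -/
@[simp] theorem swap_app (z : E²) : swap.app z = vec2 (z 1) (z 0) := by
  rw [app_apply]; simp [swap]

/-- The determinant of the swap frame. [folklore] -/
@[simp] theorem swap_det : swap.det = -1 := by simp [det, swap]

/-- The inverse of the swap frame. [folklore] -/
@[simp] theorem swap_inv (w : E²) : swap.inv w = vec2 (w 1) (w 0) := by
  rw [inv_apply, swap_det]; simp [swap]

/-- The flip frame map. [folklore] -/
@[simp] theorem flipY_app (z : E²) : flipY.app z = vec2 (z 0) (-z 1) := by
  rw [app_apply]; simp [flipY]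

/-- The determinant of the flip frame. [folklore] -/
@[simp] theorem flipY_det : flipY.det = -1 := by simp [det, flipY]

/-- The inverse of the flip frame. [folklore] -/
@[simp] theorem flipY_inv (w : E²) : flipY.inv w = vec2 (w 0) (-w 1) := by
  rw [inv_apply, flipY_det, vec2_eq_vec2_iff]; simp [flipY]; ring

/-- The diagonal frame map. [folklore] -/
@[simp] theorem diag_app (z : E²) : diag.app z = vec2 (z 0 - z 1) (z 0 + z 1) := by
  rw [app_apply, vec2_eq_vec2_iff]; simp [diag]; ring

/-- The determinant of the diagonal frame. [folklore] -/
@[simp] theorem diag_det : diag.det = 2 := by simp [det, diag]; norm_num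

/-- The anti-diagonal frame map. [folklore] -/
@[simp] theorem antiDiag_app (z : E²) : antiDiag.app z = vec2 (z 0 + z 1) (z 1 - z 0) := by
  rw [app_apply, vec2_eq_vec2_iff]; simp [antiDiag]; ring

/-- The determinant of the anti-diagonal frame. [folklore] -/
@[simp] theorem antiDiag_det : antiDiag.det = 2 := by simp [det, antiDiag]; norm_num

end LinFrame

end PlanarKinematics

end Literature.Analysis.FluidPDE
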